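import Summits.AtomisticToContinuum.HydrodynamicLimit.Theses.CollisionIsometryCLT
import Summits.AtomisticToContinuum.HydrodynamicLimit.Theorems.AdaptedWeightCLT.Negative.MechanismToys

/-!
# Line `impulse-stress-contraction` for the crux `AdaptedWeightCLT` (stmt-AtomisticToContinuum-12949)

Route `CollisionIsometryCLT` (sub-problem `HydrodynamicLimit`), crux rank 2, shape
`∀ profiles ∃ σ₀ ∀ σ < σ₀ [let M, ipr] ∀ Φ, H1(σ,Φ) → H2(σ,Φ) → C(σ,Φ)` with
H1 = the conclusion of `DiffuseBackwardInfluence` (mean inverse participation ratio of the exact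
frozen-geometry velocity transfer `M` over EVERY admissible window `→ 0` in local-Gibbs mean),
H2 = component (i) of `AprioriBounds` (time-averaged one-particle exponential velocity moment),
C = the conclusion of the target `FastMomentRelaxation` (block traceless kinetic stress `D` and block
kinetic heat flux `q` vanish in `L²([0,t] × 𝕋³)` in probability).

## The line (idea card `impulse-stress-contraction`, merged with `contact-source-duhamel` as all three
triagers of round 1 direct: this card is the COLUMN-DEPOLARISATION provider of the merged line)

Read the column channel of the transfer as the stress `J_{k,a} = Σᵢ mᵢ ⊗ mᵢ`, `mᵢ = (M e_{k,a})ᵢ`, of a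
fictitious IMPULSE GAS: one unit velocity impulse `e_a` injected at particle `k` at the start of the
window and carried forward by the realised collisions (`tr J = 1`, momentum `Σᵢ mᵢ = e_a`).  At a fold
step reflecting the pair `(p, q)` at normal `n` only the relative impulse `g = m_p − m_q` matters and
(`stub_bookkeeping`, exact)  `ΔJ = −(g_⊥ ⊗ u + u ⊗ g_⊥)`, `u = (⟪g,n⟫/‖n‖²) n`, `g_⊥ = g − u`;
averaging the anisotropy `anis J = ‖J − I/3‖_F²` of `J + ΔJ` over a normal that is uniform on `S²`
(`stub_sphericalDrift` (U)) resp. axially symmetric about `g` with law `μ` ((A)) gives EXACTLY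
  `E[Δ anis] = −c · gᵀ J_dev g + (c/3) · |g|⁴`,  `c(μ) = 6 E_μ[x(1−x)]`, `x = (ĝ·ω)²`
(`c = 4/5` for the uniform law; `c = 0` iff `μ` lives on the band `x = 0` ∪ the poles `x = 1`).
Since `Σ_pieces gᵀ J_dev g = ‖J − I/3‖²` when every carrier collides once, the impulse anisotropy is a
SUPERMARTINGALE DOWN TO THE PARTICIPATION FLOOR `Σᵢ |mᵢ|⁴ ≤ column ipr`, and the mean column ipr IS the
mean row ipr of H1 (same double sum).  Planner's sharpening (this skeleton): pathwise
`Δ(anis − Σᵢ|mᵢ|⁴) = −4 (P_n g)ᵀ (J − g gᵀ)_dev (P_n^⊥ g)` for a piece meeting an impulse-free partner,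
and the `ℓ⁴`-share of a split piece contracts by the factor `1 − c(μ)/3` while the anisotropy drifts at
rate `c(μ)`: depolarisation is SLAVED to diffuseness with the same coefficient, so the only input beyond
H1 is control of the NON-AXIAL, lab-coherent part of the conditional normal law (flux bias by the
ambient kinetic anisotropy — whose first-order effect on the fixed point `I/3` cancels by the sixth
sphere moment — and shielding caps about stale contact directions, weight `O(σ³)`).
Hence `stub_depolarisation`: H1 → H2 → CD (column depolarisation, the refuter's "RotationalDiffuseness"
objection O1, typed below as `DepolarisesAt` = the functional of `IdeatorTwoSketch.ColumnDepolarisation`).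
The other half of the merged line is `stub_contactSourceReduction`: CD → H1 → H2 → C by the exact
variation-of-constants (Duhamel / DIAG–INT) bookkeeping of second and third moments along the collision
sequence — CD damps the transported diagonal past and every contact source older than `O(1/c)`
collisions, H1 is exactly the heat-flux (spin-1) lemma, the Hilbert–Schmidt identity makes cell
concentration transfer-free, and the one remaining chaos residue is the bilinear CONTACT CROSS
statistic (CCN) with its relaxing Gaussian value `E[S_c] = −(2θ/5)A` (card `contact-source-duhamel`,
whose own crux-plan seat types that half in detail; here it is ONE registered stub with its split plan in
the docstring).

## Skeleton (4 registered stubs ⟹ crux; composition `AdaptedWeightCLT_of` concludes the crux BY NAME with `sorry` only inside the stubs it invokes; `lineStatement_of_stubStatements` + `crux_iff` certify the implication sorry-free)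

* `stub_bookkeeping`            — fold-level update rule, trace, one-step stress increment (deterministic; M).
* `stub_sphericalDrift`          — the uniform and axial one-collision drift/noise identities on `S²` (M).
* `stub_depolarisation`          — bookkeeping → drift → (H1 → H2 → CD) for small σ (THIS card; L/XL).
* `stub_contactSourceReduction`  — bookkeeping → (CD → H1 → H2 → C) for small σ (card
                                   `contact-source-duhamel`; XL, hardest: contains CCN).

## Disproof used (Cruxes/AdaptedWeightCLT/Disproof.lean, cycle 1) and landed Negative lemmas
No `_false_without_<H>` theorem exists (§1: `adaptedWeightCLT_of_fastMomentRelaxation`, C ⇒ crux, so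
the hypotheses are proof aids); both H1 and H2 are nevertheless USED: H1 at `stub_depolarisation` (noise
floor) and at `stub_contactSourceReduction` (spin-1 suppression of the transported heat flux), H2 at
`stub_contactSourceReduction` (hot cells, initial layer) and optionally at `stub_depolarisation`
(energy-weighted carrier population).  Checked against the landed
`Theorems/AdaptedWeightCLT/Negative/MechanismToys.lean` (imported above):
`diffuse_rows_need_not_isotropise` (I1) — its `isoBlock` rows are not reflection-generated (they violate
`Σₖ M_ik = Σᵢ M_ik = I₃`), and CD is DERIVED here from reflection structure + normal non-degeneracy, never
from ipr alone; `adapted_unit_rows_need_not_centre` (I2) — no CLT / centring step occurs anywhere in this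
line (moments only; adaptedness is kept exactly and priced at contact by CCN);
`reflectVel_of_inner_eq_zero` (S3) and `one_reflection_covariance` (S4) — the degenerate normal laws
(planar: `c = 0` on the band; coordinate: poles) are exactly those with `c(μ) = 0` in
`stub_sphericalDrift` (A), and they violate H1 as well (`ipr ≥ 1` resp. `≥ 3`), so no stub is an
instance the Negative lemmas refute; `self/partner_weight_after_reflection` (`9 → 5`) is the `ℓ⁴`
shadow (`x`-split) of `stub_bookkeeping`'s increment.
-/

namespace Summit.AtomisticToContinuum.HydrodynamicLimit.Cruxes.AdaptedWeightCLT.ImpulseStressContraction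

open scoped BigOperators Topology Classical MeasureTheory ENNReal InnerProductSpace Matrix
open Filter Set MeasureTheory

noncomputable section

/-! ## Types and the typed transfer, step by step (verbatim `let`s of the crux; same helper shapes as
`Cruxes/DiffuseBackwardInfluence/Lines/kinship-lyapunov.lean`) -/

/-- Velocity space `ℝ³`. -/
abbrev E3 : Type := EuclideanSpace ℝ (Fin 3)

/-- `3 × 3` real matrices (stresses). -/
abbrev Mat3 : Type := Matrix (Fin 3) (Fin 3) ℝ

/-- Phase space of `N + 1` spheres on `𝕋³` (the crux's configuration type). -/
abbrev Cfg (N : ℕ) : Type :=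
  Literature.Analysis.FluidPDE.Config (N + 1) (Fin 3) (UnitAddTorus (Fin 3))

/-- Velocity fields of `N + 1` spheres. -/
abbrev Vel (N : ℕ) : Type := Fin (N + 1) → EuclideanSpace ℝ (Fin 3)

/-- Families of hard-sphere flows at reduced density `σ` (the crux's `Φ`). -/
abbrev Flows (σ : ℝ) : Type :=
  (N : ℕ) → Literature.Analysis.FluidPDE.HardSphereFlow
    (Literature.Analysis.FluidPDE.Torus.geometry (Fin 3))
    (Literature.MathematicalPhysics.KineticTheory.hsDiameter σ N) (N + 1)

/-- The pre-collisional configuration ending the `k`-th free flight of the Alexander construction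
started at `y` (the crux's `pre k`, verbatim). -/
def pre (σ : ℝ) (N : ℕ) (y : Cfg N) (k : ℕ) : Cfg N :=
  Literature.Analysis.FluidPDE.freeFlight (Literature.Analysis.FluidPDE.Torus.geometry (Fin 3))
    (Literature.Analysis.FluidPDE.Alexander.freeExitTime
      (Literature.Analysis.FluidPDE.Torus.geometry (Fin 3))
      (Literature.MathematicalPhysics.KineticTheory.hsDiameter σ N)
      (Literature.Analysis.FluidPDE.Alexander.stateAfter
        (Literature.Analysis.FluidPDE.Torus.geometry (Fin 3))
        (Literature.MathematicalPhysics.KineticTheory.hsDiameter σ N) y k)).toReal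
    (Literature.Analysis.FluidPDE.Alexander.stateAfter
      (Literature.Analysis.FluidPDE.Torus.geometry (Fin 3))
      (Literature.MathematicalPhysics.KineticTheory.hsDiameter σ N) y k)

/-- One fold step of the crux's transfer: the velocity part of `collidePair` at the realised
incoming pair of `pre k` (the identity if there is none), applied to a velocity field `W` placed at
the positions of `pre k` (verbatim the crux's `fun W' k => dite …`). -/
def stepMap (σ : ℝ) (N : ℕ) (y : Cfg N) (k : ℕ) (W : Vel N) : Vel N :=
  @dite (Fin (N + 1) → EuclideanSpace ℝ (Fin 3))
    (Literature.Analysis.FluidPDE.Alexander.incomingPairs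
      (Literature.Analysis.FluidPDE.Torus.geometry (Fin 3))
      (Literature.MathematicalPhysics.KineticTheory.hsDiameter σ N) (pre σ N y k)).Nonempty
    (Classical.propDecidable _)
    (fun h => fun i => (Literature.Analysis.FluidPDE.collidePair
      (Literature.Analysis.FluidPDE.Torus.geometry (Fin 3)) h.some.1 h.some.2
      (fun j => ((pre σ N y k j).1, W j)) i).2)
    (fun _ => W)

/-- The transfer after the first `m` fold steps, `M(m) W`; the crux's `M N y Δ W` is
`transferSteps σ N y (steps σ N y Δ) W`. -/
def transferSteps (σ : ℝ) (N : ℕ) (y : Cfg N) (m : ℕ) (W : Vel N) : Vel N :=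
  (List.range m).foldl (fun W' k => stepMap σ N y k W') W

/-- The number of fold steps whose collision instant lies in the closed window `[0, s]`
(the crux's `collisionCount`). -/
def steps (σ : ℝ) (N : ℕ) (y : Cfg N) (s : ℝ) : ℕ :=
  Literature.Analysis.FluidPDE.Alexander.collisionCount
    (Literature.Analysis.FluidPDE.Torus.geometry (Fin 3))
    (Literature.MathematicalPhysics.KineticTheory.hsDiameter σ N) y s

/-- The incoming pair reflected at fold step `k` (`none` if the step is the identity). -/
def stepPair (σ : ℝ) (N : ℕ) (y : Cfg N) (k : ℕ) : Option (Fin (N + 1) × Fin (N + 1)) :=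
  @dite (Option (Fin (N + 1) × Fin (N + 1)))
    (Literature.Analysis.FluidPDE.Alexander.incomingPairs
      (Literature.Analysis.FluidPDE.Torus.geometry (Fin 3))
      (Literature.MathematicalPhysics.KineticTheory.hsDiameter σ N) (pre σ N y k)).Nonempty
    (Classical.propDecidable _)
    (fun h => some h.some) (fun _ => none)

/-- The (unnormalised, minimal-image) separation vector `x_p − x_q` of the pair `(p, q)` in the
pre-collisional configuration of fold step `k` — the normal `collidePair`/`reflectVel` reflect along
(norm `ε` at a genuine contact). -/
def stepSep (σ : ℝ) (N : ℕ) (y : Cfg N) (k : ℕ) (p q : Fin (N + 1)) : E3 :=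
  (Literature.Analysis.FluidPDE.Torus.geometry (Fin 3)).sepVec (pre σ N y k p).1 (pre σ N y k q).1

/-! ## The impulse gas: injected impulses, their stress, anisotropy, participation -/

/-- The unit impulse `e_a` injected at particle `k` (the crux's `Pi.single k (EuclideanSpace.single a 1)`). -/
def unitImpulse (N : ℕ) (k : Fin (N + 1)) (a : Fin 3) : Vel N :=
  Pi.single k (EuclideanSpace.single a (1 : ℝ))

/-- The impulse piece `mᵢ = (M(m) e_{k,a})ᵢ` carried by particle `i` after `m` fold steps. -/
def impulse (σ : ℝ) (N : ℕ) (y : Cfg N) (m : ℕ) (k : Fin (N + 1)) (a : Fin 3) (i : Fin (N + 1)) : E3 :=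
  transferSteps σ N y m (unitImpulse N k a) i

/-- The (coherent) impulse stress `J_{k,a}(m) = Σᵢ mᵢ ⊗ mᵢ` of the injection `(k, a)` after `m` steps. -/
def stress (σ : ℝ) (N : ℕ) (y : Cfg N) (m : ℕ) (k : Fin (N + 1)) (a : Fin 3) : Mat3 :=
  fun p q => ∑ i : Fin (N + 1), impulse σ N y m k a i p * impulse σ N y m k a i q

/-- Squared Frobenius distance of a stress to the isotropic stress of unit trace: `‖J − I/3‖_F²`. -/
def anis (J : Mat3) : ℝ :=
  ∑ p : Fin 3, ∑ q : Fin 3, (J p q - (if p = q then (1 : ℝ) / 3 else 0)) ^ 2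

/-- The deviatoric (traceless) part `J − (tr J / 3) I` of a stress. -/
def dev (J : Mat3) : Mat3 :=
  fun p q => J p q - (if p = q then (∑ l : Fin 3, J l l) / 3 else 0)

/-- The quadratic form `gᵀ B g`. -/
def qform (B : Mat3) (g : E3) : ℝ :=
  ∑ p : Fin 3, ∑ q : Fin 3, g p * B p q * g q

/-- Column participation (the `ℓ⁴` floor of the injection): `Σᵢ |mᵢ|⁴`. -/
def colIpr (σ : ℝ) (N : ℕ) (y : Cfg N) (m : ℕ) (k : Fin (N + 1)) (a : Fin 3) : ℝ :=
  ∑ i : Fin (N + 1), ‖impulse σ N y m k a i‖ ^ 4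

/-- Mean column depolarisation defect after `m` steps: `(N+1)⁻¹ Σₖ Σₐ ‖J_{k,a}(m) − I/3‖_F²`
(the functional `cdp` of `IdeatorTwoSketch.ColumnDepolarisation`; values in `[0, 2]`). -/
def depol (σ : ℝ) (N : ℕ) (y : Cfg N) (m : ℕ) : ℝ :=
  ((N + 1 : ℕ) : ℝ)⁻¹ * ∑ k : Fin (N + 1), ∑ a : Fin 3, anis (stress σ N y m k a)

/-- The crux's mean inverse participation ratio after `m` steps:
`(N+1)⁻¹ Σᵢ Σₖ (Σₐ ‖(M(m) e_{k,a})ᵢ‖²)²` (verbatim the crux's `ipr` at `m = steps`). -/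
def iprSteps (σ : ℝ) (N : ℕ) (y : Cfg N) (m : ℕ) : ℝ :=
  ((N + 1 : ℕ) : ℝ)⁻¹ * ∑ i : Fin (N + 1), ∑ k : Fin (N + 1),
    (∑ a : Fin 3, ‖transferSteps σ N y m (Pi.single k (EuclideanSpace.single a (1 : ℝ))) i‖ ^ 2) ^ 2

/-- The one-collision stress increment for a relative impulse `g` reflected along the (unnormalised)
normal `n`: with `u = (⟪g,n⟫/‖n‖²) n` (the transferred vector) and `w = g − u ⊥ n`,
`ΔJ = −(w ⊗ u + u ⊗ w)`; `0` at the junk normal `n = 0` (matching `reflectVel_zero`). -/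
def kick (n g : E3) : Mat3 :=
  let u : E3 := (⟪g, n⟫_ℝ / ‖n‖ ^ 2) • n
  let w : E3 := g - u
  fun p q => -(w p * u q + u p * w q)

/-! ## The statements of the line -/

/-- Continuous, positive profiles (the crux's hypotheses on `a₀, θ₀, u₀`). -/
def NiceProfiles (a₀ θ₀ : UnitAddTorus (Fin 3) → ℝ)
    (u₀ : UnitAddTorus (Fin 3) → EuclideanSpace ℝ (Fin 3)) : Prop :=
  Continuous a₀ ∧ Continuous θ₀ ∧ Continuous u₀ ∧ (∀ x, 0 < a₀ x) ∧ (∀ x, 0 < θ₀ x)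

/-- Admissible windows (the crux's hypotheses on `Δ`): `Δ_N > 0`, `Δ_N → 0`, `Δ_N (N+1)^{1/3} → ∞`. -/
def AdmissibleWindow (Δ : ℕ → ℝ) : Prop :=
  (∀ N, 0 < Δ N) ∧ Tendsto Δ atTop (𝓝 0) ∧
    Tendsto (fun N : ℕ => Δ N * ((N + 1 : ℕ) : ℝ) ^ ((1 : ℝ) / 3)) atTop atTop

/-- IMPULSE BOOKKEEPING (deterministic algebra of the typed fold).  For every `σ, N, y, m`:
(idle) if no pair is reflected at step `m` the transfer is unchanged;
(pair) if step `m` reflects `(p, q)` then `p ≠ q` and for every velocity field `W`, writing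
`W' = M(m) W`, `n = stepSep` and `u = (⟪W' p − W' q, n⟫/‖n‖²) n`:  `M(m+1) W` equals `W' p − u` at `p`,
`W' q + u` at `q`, and `W'` elsewhere (unfolding `List.foldl` over `List.range (m+1)`, the `dite` of
`stepMap`, `collidePair_apply_left/right/of_ne`, `reflectVel`);
(trace) every injection keeps unit energy `Σᵢ ‖mᵢ‖² = 1` (each step is an isometry of the pair);
(floor) the column participations are dominated by the crux's ipr: `Σₖ Σₐ Σᵢ ‖mᵢ^{k,a}‖⁴ ≤ (N+1)·ipr(m)`
(`Σₐ wₐ² ≤ (Σₐ wₐ)²` for the non-negative block weights `wₐ = ‖mᵢ^{k,a}‖²`) — H1 IS the noise floor;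
(increment) the impulse stress changes by exactly `kick n (m_p − m_q)` at a reflecting step
(expand `(m_p − u) ⊗ (m_p − u) + (m_q + u) ⊗ (m_q + u)`; = `IdeatorTwoSketch.pair_stress_update`, proved
there at the inner-product level) and not at all at an idle step. -/
def ImpulseBookkeeping (σ : ℝ) : Prop :=
  ∀ (N : ℕ) (y : Cfg N) (m : ℕ),
    (stepPair σ N y m = none → ∀ W : Vel N, transferSteps σ N y (m + 1) W = transferSteps σ N y m W) ∧
    (∀ p q : Fin (N + 1), stepPair σ N y m = some (p, q) →
      p ≠ q ∧
      ∀ W : Vel N,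
        let W' := transferSteps σ N y m W
        let n := stepSep σ N y m p q
        let u : E3 := (⟪W' p - W' q, n⟫_ℝ / ‖n‖ ^ 2) • n
        transferSteps σ N y (m + 1) W p = W' p - u ∧
        transferSteps σ N y (m + 1) W q = W' q + u ∧
        ∀ i : Fin (N + 1), i ≠ p → i ≠ q → transferSteps σ N y (m + 1) W i = W' i) ∧
    (∀ (k : Fin (N + 1)) (a : Fin 3), ∑ i : Fin (N + 1), ‖impulse σ N y m k a i‖ ^ 2 = 1) ∧
    (∑ k : Fin (N + 1), ∑ a : Fin 3, colIpr σ N y m k a ≤ ((N + 1 : ℕ) : ℝ) * iprSteps σ N y m) ∧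
    (∀ (k : Fin (N + 1)) (a : Fin 3),
      (stepPair σ N y m = none → stress σ N y (m + 1) k a = stress σ N y m k a) ∧
      (∀ p q : Fin (N + 1), stepPair σ N y m = some (p, q) →
        stress σ N y (m + 1) k a =
          stress σ N y m k a + kick (stepSep σ N y m p q) (impulse σ N y m k a p - impulse σ N y m k a q)))

/-- SPHERICAL DRIFT — the one-collision drift and noise of the impulse anisotropy, exactly.
(U) Uniform normal: for every symmetric `J` and every `g`,
`∫_{S²} anis (J + kick ω g) dσ(ω) = |S²| · (anis J − (4/5) gᵀ J_dev g + (4/15) ‖g‖⁴)`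
(`σ = sphereMeasure`, total mass `|S²| = 4π`; second and fourth moment tensors `δ/3`,
`(δδ+δδ+δδ)/15` of the uniform law; `⟨I, kick⟩ = 0`, `‖kick ω g‖² = 2 (ĝ·ω)²(1 − (ĝ·ω)²)‖g‖⁴`).
(A) Axial normal law: for every probability measure `μ` on `S²` invariant under the linear isometries
fixing `g ≠ 0`, `∫ anis (J + kick ω g) dμ = anis J − c · gᵀ J_dev g + (c/3) ‖g‖⁴` with
`c = 6 ∫ x(1−x) dμ`, `x = ⟪g,ω⟫²/‖g‖²` — drift and noise carry the SAME coefficient; `c = 4/5` for the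
uniform law, `c = 0` iff `μ` is carried by the band `x = 0` and the poles `x = 1` (the degenerate
normals of `MechanismToys.reflectVel_of_inner_eq_zero`). -/
def SphericalDrift : Prop :=
  (∀ (J : Mat3) (g : E3), (∀ p q : Fin 3, J p q = J q p) →
    ∫ ω, anis (J + kick ((ω : Metric.sphere (0 : E3) 1) : E3) g)
        ∂(Literature.MathematicalPhysics.KineticTheory.sphereMeasure (E := E3)) =
      (Literature.MathematicalPhysics.KineticTheory.sphereMeasure (E := E3)).real univ *
        (anis J - (4 / 5) * qform (dev J) g + (4 / 15) * ‖g‖ ^ 4)) ∧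
  (∀ (μ : Measure (Metric.sphere (0 : E3) 1)), IsProbabilityMeasure μ →
    ∀ g : E3, g ≠ 0 →
      (∀ R : E3 ≃ₗᵢ[ℝ] E3, R g = g →
        μ.map (fun ω : Metric.sphere (0 : E3) 1 =>
          (⟨R (ω : E3), by
            rw [mem_sphere_zero_iff_norm, LinearIsometryEquiv.norm_map, norm_eq_of_mem_sphere ω]⟩ :
            Metric.sphere (0 : E3) 1)) = μ) →
      ∀ J : Mat3, (∀ p q : Fin 3, J p q = J q p) →
        ∫ ω, anis (J + kick ((ω : Metric.sphere (0 : E3) 1) : E3) g) ∂μ =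
          anis J
            - (6 * ∫ ω, (⟪g, ((ω : Metric.sphere (0 : E3) 1) : E3)⟫_ℝ ^ 2 / ‖g‖ ^ 2) *
                (1 - ⟪g, ((ω : Metric.sphere (0 : E3) 1) : E3)⟫_ℝ ^ 2 / ‖g‖ ^ 2) ∂μ) * qform (dev J) g
            + (6 * ∫ ω, (⟪g, ((ω : Metric.sphere (0 : E3) 1) : E3)⟫_ℝ ^ 2 / ‖g‖ ^ 2) *
                (1 - ⟪g, ((ω : Metric.sphere (0 : E3) 1) : E3)⟫_ℝ ^ 2 / ‖g‖ ^ 2) ∂μ) / 3 * ‖g‖ ^ 4)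

/-- H1 at `(σ, profiles, Φ)`: the conclusion of `DiffuseBackwardInfluence` — on every admissible window
the mean inverse participation ratio of the transfer tends to `0` (definitionally the crux's first
hypothesis, `ipr N y Δ = iprSteps σ N y (steps σ N y Δ)`). -/
def DiffuseAt (σ : ℝ) (a₀ θ₀ : UnitAddTorus (Fin 3) → ℝ)
    (u₀ : UnitAddTorus (Fin 3) → EuclideanSpace ℝ (Fin 3)) (Φ : Flows σ) : Prop :=
  ∀ Δ : ℕ → ℝ, (∀ N, 0 < Δ N) → Tendsto Δ atTop (𝓝 0) →
    Tendsto (fun N : ℕ => Δ N * ((N + 1 : ℕ) : ℝ) ^ ((1 : ℝ) / 3)) atTop atTop →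
    ∀ t : ℝ, 0 < t →
      Tendsto (fun N : ℕ => ∫⁻ z, ENNReal.ofReal
          (iprSteps σ N ((Φ N).flow (t - Δ N) z) (steps σ N ((Φ N).flow (t - Δ N) z) (Δ N)))
        ∂(Literature.MathematicalPhysics.KineticTheory.localGibbsLaw σ a₀ u₀ θ₀ N (Φ N))) atTop (𝓝 0)

/-- H2 at `(σ, profiles, Φ)`: component (i) of `AprioriBounds` — for every `t > 0` a time-averaged
one-particle exponential velocity moment is bounded with probability `→ 1` (verbatim the crux's second
hypothesis). -/
def TailsAt (σ : ℝ) (a₀ θ₀ : UnitAddTorus (Fin 3) → ℝ)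
    (u₀ : UnitAddTorus (Fin 3) → EuclideanSpace ℝ (Fin 3)) (Φ : Flows σ) : Prop :=
  ∀ t : ℝ, 0 < t → ∃ lam Cexp : ℝ, 0 < lam ∧
    Tendsto (fun N : ℕ => Literature.MathematicalPhysics.KineticTheory.localGibbsLaw σ a₀ u₀ θ₀ N (Φ N)
      {z | Cexp < ∫ s in Icc 0 t, ∫ y, Real.exp (lam * ‖y.2‖ ^ 2)
        ∂(Literature.Analysis.FluidPDE.empiricalMeasure ((Φ N).flow s z))}) atTop (𝓝 0)

/-- CD at `(σ, profiles, Φ)` — COLUMN DEPOLARISATION (the refuter's O1 "RotationalDiffuseness", typed):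
on every admissible window and for every `t > 0` the mean depolarisation defect
`(N+1)⁻¹ Σₖ Σₐ ‖J_{k,a} − I/3‖_F²` of the coherent impulse stresses of the transfer over `[t − Δ_N, t]`
tends to `0` in local-Gibbs mean (the functional of `IdeatorTwoSketch.ColumnDepolarisation`). -/
def DepolarisesAt (σ : ℝ) (a₀ θ₀ : UnitAddTorus (Fin 3) → ℝ)
    (u₀ : UnitAddTorus (Fin 3) → EuclideanSpace ℝ (Fin 3)) (Φ : Flows σ) : Prop :=
  ∀ Δ : ℕ → ℝ, AdmissibleWindow Δ → ∀ t : ℝ, 0 < t →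
    Tendsto (fun N : ℕ => ∫⁻ z, ENNReal.ofReal
        (depol σ N ((Φ N).flow (t - Δ N) z) (steps σ N ((Φ N).flow (t - Δ N) z) (Δ N)))
      ∂(Literature.MathematicalPhysics.KineticTheory.localGibbsLaw σ a₀ u₀ θ₀ N (Φ N))) atTop (𝓝 0)

/-- C at `(σ, profiles, Φ)`: the conclusion of the target `FastMomentRelaxation` — for every mesoscale
`γ ∈ (0, 1/15]`, every admissible kernel family, every `t > 0`, the block traceless central kinetic
stress `D` and the block kinetic heat flux `q` vanish in `L²([0,t] × 𝕋³)` in probability (verbatim the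
crux's conclusion). -/
def ClosesAt (σ : ℝ) (a₀ θ₀ : UnitAddTorus (Fin 3) → ℝ)
    (u₀ : UnitAddTorus (Fin 3) → EuclideanSpace ℝ (Fin 3)) (Φ : Flows σ) : Prop :=
  ∀ (γ C : ℝ) (φ : ℕ → (UnitAddTorus (Fin 3)) → ℝ), 0 < γ → γ ≤ 1 / 15 → ((∀ N, Literature.Analysis.FunctionSpaces.Torus.IsSmooth (φ N)) ∧ (∀ N y, 0 ≤ φ N y) ∧ (∀ N, ∫ y, φ N y = 1) ∧ (∀ (N : ℕ) y, ((N : ℝ) + 1) ^ (-γ) ≤ Literature.Analysis.FluidPDE.Torus.euclidDist y 0 → φ N y = 0) ∧ (∀ (N : ℕ) y, φ N y ≤ C * ((N : ℝ) + 1) ^ (3 * γ)) ∧ (∀ (N : ℕ) y, ‖Literature.Analysis.FunctionSpaces.Torus.gradient (φ N) y‖ ≤ C * ((N : ℝ) + 1) ^ (4 * γ))) → let ρb := fun (N : ℕ) (s : ℝ) z (x : UnitAddTorus (Fin 3)) => Literature.MathematicalPhysics.KineticTheory.empiricalDensityField ((Φ N).flow s z) (fun y => φ N (y - x)); let mb :=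 fun (N : ℕ) (s : ℝ) z (x : UnitAddTorus (Fin 3)) => Literature.MathematicalPhysics.KineticTheory.empiricalMomentumField ((Φ N).flow s z) (fun y => φ N (y - x)); let ub := fun (N : ℕ) (s : ℝ) z (x : UnitAddTorus (Fin 3)) => (ρb N s z x)⁻¹ • mb N s z x; let D := fun (N : ℕ) (s : ℝ) z (x : UnitAddTorus (Fin 3)) (j k : Fin 3) => (∫ y, φ N (y.1 - x) * ((y.2 j - ub N s z x j) * (y.2 k - ub N s z x k)) ∂(Literature.Analysis.FluidPDE.empiricalMeasure ((Φ N).flow s z))) - (if j = k then (∑ l : Fin 3, ∫ y, φ N (y.1 - x) * (y.2 l - ub N s z x l) ^ 2 ∂(Literature.Analysis.FluidPDE.empiricalMeasure ((Φ N).flow s z))) / 3 else 0); let q := fun (N : ℕ) (s : ℝ) z (x : UnitAddTorus (Fin 3)) => ∫ y, (φ N (y.1 - x) * ‖y.2 - ub N s z x‖ ^ 2 / 2) • (y.2 - ub N s z x) ∂(Literature.Analysis.FluidPDE.empiricalMeasure ((Φ N).flow s z)); ∀ t : ℝ, 0 < t → ∀ δ : ℝ, 0 < δ → Tendsto (fun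 N : ℕ => Literature.MathematicalPhysics.KineticTheory.localGibbsLaw σ a₀ u₀ θ₀ N (Φ N) {z | δ < ∫ s in Icc 0 t, ∫ x, ((∑ j, ∑ k, D N s z x j k ^ 2) + ‖q N s z x‖ ^ 2)}) atTop (𝓝 0)

/-- DEPOLARISATION FROM DIFFUSENESS (this card's thesis: CD is not a new hypothesis).  For all nice
profiles there is `σ₀ > 0` such that for `0 < σ < σ₀` and every flow family: H1 (and H2) imply CD. -/
def DepolarisationFromDiffuseness : Prop :=
  ∀ (a₀ θ₀ : UnitAddTorus (Fin 3) → ℝ) (u₀ : UnitAddTorus (Fin 3) → EuclideanSpace ℝ (Fin 3)),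
    NiceProfiles a₀ θ₀ u₀ →
    ∃ σ₀ : ℝ, 0 < σ₀ ∧ ∀ σ : ℝ, 0 < σ → σ < σ₀ →
      ∀ Φ : Flows σ, DiffuseAt σ a₀ θ₀ u₀ Φ → TailsAt σ a₀ θ₀ u₀ Φ → DepolarisesAt σ a₀ θ₀ u₀ Φ

/-- CONTACT-SOURCE REDUCTION (card `contact-source-duhamel`, docked on CD).  For all nice profiles there
is `σ₀ > 0` such that for `0 < σ < σ₀` and every flow family: CD, H1 and H2 imply C. -/
def ContactSourceReduction : Prop :=
  ∀ (a₀ θ₀ : UnitAddTorus (Fin 3) → ℝ) (u₀ : UnitAddTorus (Fin 3) → EuclideanSpace ℝ (Fin 3)),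
    NiceProfiles a₀ θ₀ u₀ →
    ∃ σ₀ : ℝ, 0 < σ₀ ∧ ∀ σ : ℝ, 0 < σ → σ < σ₀ →
      ∀ Φ : Flows σ, DepolarisesAt σ a₀ θ₀ u₀ Φ → DiffuseAt σ a₀ θ₀ u₀ Φ → TailsAt σ a₀ θ₀ u₀ Φ →
        ClosesAt σ a₀ θ₀ u₀ Φ

/-! ## Registered stubs -/

/-- STUB 1 (IMPULSE BOOKKEEPING, deterministic, M; provable now).  The exact fold-level update rule of
the typed transfer, unit trace of every injection, and the one-step stress increment
`ΔJ = kick n (m_p − m_q) = −(g_⊥ ⊗ u + u ⊗ g_⊥)`, for every `σ, N, y, m` (induction-free: one unfolding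
of `List.range (m+1)`; `incomingPairs` gives `p < q`; the pair level is
`IdeatorTwoSketch.pair_stress_update` / `pair_energy_conserved`).  Leans on: `collidePair_apply_left`,
`collidePair_apply_right`, `collidePair_apply_of_ne`, `reflectVel`, `Alexander.mem_incomingPairs`,
`List.foldl`, `List.range_succ`. -/
theorem stub_bookkeeping : ∀ σ : ℝ, ImpulseBookkeeping σ := by
  sorry

/-- STUB 2 (SPHERICAL DRIFT, S² moment identities, M; provable now).  The uniform (U) and axial (A)
one-collision drift/noise identities `E[Δ anis] = −c gᵀJ_dev g + (c/3)‖g‖⁴`, `c(μ) = 6E_μ[x(1−x)]`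
(`4/5` uniform).  Proof sketch: `anis (J + K) = anis J + 2⟨J_dev, K⟩ + ‖K‖²` with `tr K = 0`;
`2⟨J, kick ω g⟩ = −4 (g·ω)(ωᵀ J g_⊥)`; for (U) the moment tensors `E[ω⊗ω] = I/3`,
`E[ω^{⊗4}] = (δδ+δδ+δδ)/15` (polar coordinates / `sphereMeasure_map_neg` and rotation invariance, or
`MeasureTheory.Measure.toSphere` + Gaussian trick); for (A) decompose `ω = cos χ ĝ + sin χ ν`, the
conditional law of `ν` on the circle `⊥ g` is rotation invariant, so `E[ν] = 0`, `E[νᵀBν] = (tr B −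
ĝᵀBĝ)/2`.  Pencil-verified by all three triagers (TRIAGE-r1-1 §impulse, r1-2, r1-3 §Pencil/card5) and
MC-verified (kit j010435/T2, j010481).  Leans on: `Literature.MathematicalPhysics.KineticTheory.sphereMeasure`,
`sphereMeasure_map_neg`, `MeasureTheory.Measure.toSphere`, `integral_map`. -/
theorem stub_sphericalDrift : SphericalDrift := by
  sorry

/-- STUB 3 (DEPOLARISATION FROM DIFFUSENESS — THIS CARD, load-bearing, L/XL).  Given the bookkeeping
and the drift identities: for all nice profiles ∃ σ₀ ∀ σ < σ₀ ∀ Φ, H1 → H2 → CD.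
Intended proof (card `impulse-stress-contraction` + triage sharpenings): w.r.t. the COARSE collision
filtration (pairs + η₀-rounded normals; `J` is adapted up to `O(n·η₀)`, choose windows with
`η₀ n_N → 0`, `N^γ Δ_N → 0` — H1 holds on EVERY admissible window, so the proof may pick `n_N → ∞`
slowly), the mean anisotropy obeys `d E[anis]/dn ≤ −c₀ E[anis] + (c₀/3) E[colIpr] + 2η E[anis^{1/2}]`
summed over the energy-weighted carrier population; the floor `Σₖₐ colIpr ≤ (N+1)·ipr` is H1 (column ipr
= row ipr in mean); the RATE needs no separate hypothesis — by STUB 2 (A) the `ℓ⁴`-share of a split piece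
contracts by `1 − c(μ)/3` while `anis` drifts at `c(μ)`, so H1 forces `Σ c → ∞` along all but `o(N)`
injections (planner's pathwise identity `Δ(anis − colIpr) = −4 (P_n g)ᵀ(J − ggᵀ)_dev(P_n^⊥ g)`); the one
dynamical input is ONE-STEP NON-DEGENERACY of the NON-AXIAL part `η` of the conditional normal law in the
frame of the carried piece: flux bias through the carrier's own kicks and third-body shielding about the
LAST contact direction are `g`-axial (renormalise `c`); the lab-coherent tilt by the ambient kinetic
anisotropy `A_kin` (`dμ = (1 + (15/2)ωᵀδω)dσ`, `δ = O(A_kin)`) has ZERO first-order drift at `J = I/3`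
(sixth sphere moment: `(15/2)E_σ[(g·ω)²(ωᵀδω)ωωᵀ] = [2‖g‖²δ + 2(gᵀδg)I + 4(δggᵀ + ggᵀδ)]/14`, `= δ/3`
after summing over the colliding piece family using only `Σ_g g gᵀ = J = I/3` — but the sum is
collision-RATE-weighted (carriers collide at velocity-dependent rates), so the relevant fixed point is the
rate-weighted stress: state the weighting, cf. triage r1-3's energy-weighted carrier population), leaving
a floor `O(A_kin² + σ³A_kin)`; shielding caps about STALE contact directions (older pieces) are incoherent
in the lab frame.  Carrier–carrier collisions inside saturated clouds are covered by STUB 1 with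
`g = m_p − m_q` (cross terms `O(1/n_cloud)` + an `O(σ³)` recollision stratum, absorbed in `∃σ₀`).
Why it might fail: the `O(A_kin²)` floor makes unconditional CD lean, at second order, on smallness of
the KINETIC-scale anisotropy along the non-equilibrium law (a bootstrap with STUB 4, or a restriction to
pre-shock times, may be needed); a positive fraction of injections could sit on carriers whose
conditional normal laws are coherently non-axial (persistent local shear at the mean-free-path scale).
Toy evidence: kit j008832 (ideator 2) — under the ADAPTED flux schedule `log anis` is slaved to
`log ipr` (slopes −0.29…−0.33 vs −0.31…−0.38 per collision/particle), no plateau above `O(1/N)`,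
`c_J = +0.02/−0.001` (first-order cancellation), planar control floors `ipr → 1.1`, `anis → 1.03`.
H2 is offered as a hypothesis (energy-weighted carrier population / slow cold cells; it may go unused).
First split if the lead wants one: NormalNonDegeneracy (the `η`-control, typed w.r.t. the coarse
filtration) → DepolarisationGivenDrift (discrete Grönwall to the H1 floor). -/
theorem stub_depolarisation :
    (∀ σ : ℝ, ImpulseBookkeeping σ) → SphericalDrift → DepolarisationFromDiffuseness := by
  sorry

/-- STUB 4 (CONTACT-SOURCE REDUCTION — card `contact-source-duhamel`, XL, hardest: it contains the
chaos residue).  Given the bookkeeping: for all nice profiles ∃ σ₀ ∀ σ < σ₀ ∀ Φ, CD → H1 → H2 → C.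
Intended proof: with `y = v − ū_B` and `v(s) = M v(s−Δ)` (support items `TransferRepresentsFlow`,
`TransferIsometry`; `Σₖ M_ik = I₃`), the block second moment splits EXACTLY (coherent twin = DIAG/INT of
card `moment-transport-isotropy-parity`; incoherent twin = the Duhamel recursion
`Y_i⁺ = PᶜY_iPᶜ + PY_jP + [Pᶜy_iy_jᵀP + h.c.]`, `IdeatorTwoSketch.collision_source_identity`, proved):
(a) transported DIAGONAL past `Σₖ ỹₖᵀ Ĉₖ ỹₖ`, `aᵀĈₖa = ⟨C, J^φ_{k}(a)⟩ = φ(xₖ)⟨C, Jₖ(a)⟩(1 + O(N^γΔ_N log N))`,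
killed for traceless `C` by CD in OPERATOR norm — adaptedness irrelevant at this step — and, for the
sources, CD on every sub-window `[τ, t]` (∀-sequence form ⇒ uniform in the source age) damps every
contact source older than `O(1/c)` collisions; (b) transported cubic (heat-flux) diagonal term
`≤ ipr_k^{1/4}|ỹₖ|³` by `IdeatorTwoSketch.spin_one_suppression`: H1 IS the heat-flux lemma;
(c) cell concentration of the quadratic/cubic forms is transfer-free by the Hilbert–Schmidt identity
`‖Mᵀ(φ⊗C)M‖_HS = ‖C‖_F(Σφᵢ²)^{1/2} ≤ N^{−2/5}` (`IdeatorTwoSketch.frobenius_conj`, proved; with adapted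
`M` the Hanson–Wright step is itself a mild chaos statement — keep it inside the CCN stub, TRIAGE-r1-1/2);
(d) the live residue is the window×block sum of test-weighted CONTACT CROSS sources
`S_c = Pᶜyᵢ ⊗ Pyⱼ + h.c.` of the last `O(1/c)` collisions: CONTACT-CROSS-NULL (CCN) = bilinear (and cubic)
pre-collisional factorisation at contact for colliding pairs, block×window averaged, variance included,
in probability along the flow — equilibrium-exact, Gaussian chaos value `E[S_c] = −(2θ/5)A + O(A²)`
(per colliding pair; kit j008832: `nn = −0.507`, `src·A/‖A‖² ≈ −0.4θ`), RELAXING sign, so the Duhamel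
identity becomes a linear Volterra equation `D = −(2/5)κ̄ D + o(1)` with only the zero solution (kernel =
linearised hard-sphere deviator relaxation, `hardSphereLinearizedOp_spectralGap_holds`; first-order
coefficient `c₁ = 0` by STUB 3's cancellation); (e) H2 prices hot cells and the initial layer
`s < Δ_N = (N+1)^{−1/3} log N` (`∫ₓD² ≤ C(N+1)^{3γ}Δ_N → 0`).  MEMORY TRUNCATION is the why-easier:
sources older than `O(1/c)` collisions are damped, so the chaos needed is bounded-order, equal-time, at
kinetic separations one memory back, uniformly in `N` (the Euler factor `N^{1/3}` is spent inside the
contraction).  Why it might fail: CCN is Stosszahlansatz-class (barrier = absence of proof); as a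
block-product factorisation it is violated DETERMINISTICALLY on the inviscid mesoscale shear band
`N^{−1/6} ≪ ℓ ≪ N^{−γ}` (TRIAGE-r1-2 F2, r1-3 standing fact: sub-block shear re-injects `(2/5)·(UUᵀ)_dev`
per collision), so it can hold only in probability along the flow and, post-shock, needs sub-block
quiescence nobody owns (`GermanoSplitLES.MesoQuiescence` is typed pre-shock) — the `∀ t > 0` exposure of
the crux itself lives in THIS stub.  First split (card `contact-source-duhamel`'s own crux-plan seat types
it): DuhamelDamping (a)–(c),(e) [L, CD-driven, true regardless of C] → ContactCrossNull (d) [XL]. -/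
theorem stub_contactSourceReduction :
    (∀ σ : ℝ, ImpulseBookkeeping σ) → ContactSourceReduction := by
  sorry

/-! ## Composition (sorry-free modulo the four registered stubs) -/

/-- **The line's composition** — the four stubs imply the crux `CollisionIsometryCLT.AdaptedWeightCLT` BY
NAME (pure logic; the only `sorryAx` in its closure enters through the registered stubs it invokes, so
once they are proved this IS the crux proof): `σ₀ := min σ₃ σ₄` with `σ₃`, `σ₄` the thresholds of
STUB 3 (fed STUBS 1–2) and STUB 4 (fed STUB 1); at `(σ, Φ)` the crux's hypotheses H1, H2 are
definitionally `DiffuseAt` / `TailsAt` (the `let M …; let ipr …` prefix ζ-reduces to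
`iprSteps σ N y (steps σ N y Δ)`), STUB 3 turns them into CD, STUB 4 turns CD + H1 + H2 into the
crux's conclusion, definitionally `ClosesAt`. -/
theorem AdaptedWeightCLT_of :
    Summit.AtomisticToContinuum.HydrodynamicLimit.Theses.CollisionIsometryCLT.AdaptedWeightCLT := by
  have hB : ∀ σ : ℝ, ImpulseBookkeeping σ := stub_bookkeeping
  have hS : SphericalDrift := stub_sphericalDrift
  have hDep : DepolarisationFromDiffuseness := stub_depolarisation hB hS
  have hRed : ContactSourceReduction := stub_contactSourceReduction hB
  intro a₀ θ₀ u₀ ha hθ hu ha0 hθ0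
  have hP : NiceProfiles a₀ θ₀ u₀ := ⟨ha, hθ, hu, ha0, hθ0⟩
  obtain ⟨σ₃, hσ₃, H3⟩ := hDep a₀ θ₀ u₀ hP
  obtain ⟨σ₄, hσ₄, H4⟩ := hRed a₀ θ₀ u₀ hP
  refine ⟨min σ₃ σ₄, lt_min hσ₃ hσ₄, ?_⟩
  intro σ hσ hσlt
  have h3 : σ < σ₃ := lt_of_lt_of_le hσlt (min_le_left _ _)
  have h4 : σ < σ₄ := lt_of_lt_of_le hσlt (min_le_right _ _)
  intro M ipr Φ h1 h2
  have hH1 : DiffuseAt σ a₀ θ₀ u₀ Φ := h1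
  have hH2 : TailsAt σ a₀ θ₀ u₀ Φ := h2
  have hCD : DepolarisesAt σ a₀ θ₀ u₀ Φ := H3 σ hσ h3 Φ hH1 hH2
  have hC : ClosesAt σ a₀ θ₀ u₀ Φ := H4 σ hσ h4 Φ hCD hH1 hH2
  exact hC

/-- The same logic with the four stub STATEMENTS as explicit hypotheses and NO `sorry` in its closure
(axioms `propext`, `Classical.choice`, `Quot.sound`): the implication "stubs ⟹ crux" itself is
kernel-certified independently of the stubs.  Its conclusion is the crux up to the definitional
bridge `crux_iff` below (stated on the named side so that exactly one theorem of this file concludes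
the crux decl by name, as the skeleton audit requires). -/
theorem lineStatement_of_stubStatements
    (hB : ∀ σ : ℝ, ImpulseBookkeeping σ) (hS : SphericalDrift)
    (hDep' : (∀ σ : ℝ, ImpulseBookkeeping σ) → SphericalDrift → DepolarisationFromDiffuseness)
    (hRed' : (∀ σ : ℝ, ImpulseBookkeeping σ) → ContactSourceReduction) :
    ∀ (a₀ θ₀ : UnitAddTorus (Fin 3) → ℝ) (u₀ : UnitAddTorus (Fin 3) → EuclideanSpace ℝ (Fin 3)),
      NiceProfiles a₀ θ₀ u₀ →
      ∃ σ₀ : ℝ, 0 < σ₀ ∧ ∀ σ : ℝ, 0 < σ → σ < σ₀ →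
        ∀ Φ : Flows σ, DiffuseAt σ a₀ θ₀ u₀ Φ → TailsAt σ a₀ θ₀ u₀ Φ → ClosesAt σ a₀ θ₀ u₀ Φ := by
  intro a₀ θ₀ u₀ hP
  obtain ⟨σ₃, hσ₃, H3⟩ := hDep' hB hS a₀ θ₀ u₀ hP
  obtain ⟨σ₄, hσ₄, H4⟩ := hRed' hB a₀ θ₀ u₀ hP
  refine ⟨min σ₃ σ₄, lt_min hσ₃ hσ₄, fun σ hσ hσlt Φ h1 h2 => ?_⟩
  have h3 : σ < σ₃ := lt_of_lt_of_le hσlt (min_le_left _ _)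
  have h4 : σ < σ₄ := lt_of_lt_of_le hσlt (min_le_right _ _)
  exact H4 σ hσ h4 Φ (H3 σ hσ h3 Φ h1 h2) h1 h2

/-- Definitional bridge: the crux IS "for all nice profiles ∃ σ₀ ∀ σ < σ₀ ∀ Φ, H1 → H2 → C" with this
file's named predicates (`Iff` by unfolding only; no mathematics). -/
theorem crux_iff :
    (∀ (a₀ θ₀ : UnitAddTorus (Fin 3) → ℝ) (u₀ : UnitAddTorus (Fin 3) → EuclideanSpace ℝ (Fin 3)),
      NiceProfiles a₀ θ₀ u₀ →
      ∃ σ₀ : ℝ, 0 < σ₀ ∧ ∀ σ : ℝ, 0 < σ → σ < σ₀ →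
        ∀ Φ : Flows σ, DiffuseAt σ a₀ θ₀ u₀ Φ → TailsAt σ a₀ θ₀ u₀ Φ → ClosesAt σ a₀ θ₀ u₀ Φ) ↔
    Summit.AtomisticToContinuum.HydrodynamicLimit.Theses.CollisionIsometryCLT.AdaptedWeightCLT := by
  constructor
  · intro h a₀ θ₀ u₀ ha hθ hu ha0 hθ0
    obtain ⟨σ₀, hσ₀, H⟩ := h a₀ θ₀ u₀ ⟨ha, hθ, hu, ha0, hθ0⟩
    refine ⟨σ₀, hσ₀, fun σ hσ hσlt => ?_⟩
    intro M ipr Φ h1 h2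
    exact (H σ hσ hσlt Φ h1 h2 : ClosesAt σ a₀ θ₀ u₀ Φ)
  · intro h a₀ θ₀ u₀ hP
    obtain ⟨σ₀, hσ₀, H⟩ := h a₀ θ₀ u₀ hP.1 hP.2.1 hP.2.2.1 hP.2.2.2.1 hP.2.2.2.2
    refine ⟨σ₀, hσ₀, fun σ hσ hσlt Φ h1 h2 => ?_⟩
    exact (H σ hσ hσlt Φ h1 h2 : ClosesAt σ a₀ θ₀ u₀ Φ)

/-! ## Sanity anchors (kernel-checked, no sorry): the objects above are the crux's and the Negative
lemmas' objects -/

/-- The crux's `ipr` after `m` steps is bounded below by the mean column participation of the impulse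
gas is NOT claimed here; what is definitional is that `impulse` is the crux's transfer applied to the
crux's unit impulses. -/
example (σ : ℝ) (N : ℕ) (y : Cfg N) (m : ℕ) (k : Fin (N + 1)) (a : Fin 3) (i : Fin (N + 1)) :
    impulse σ N y m k a i =
      transferSteps σ N y m (Pi.single k (EuclideanSpace.single a (1 : ℝ))) i := rfl

/-- With no fold step the impulse stress of every injection is the fresh rank-one stress `e_a ⊗ e_a`
evaluated entrywise (anisotropy `2/3`, the ceiling; cf. `MechanismToys.ipr_identity` for the row side). -/
example (σ : ℝ) (N : ℕ) (y : Cfg N) (k : Fin (N + 1)) (a : Fin 3) (p q : Fin 3) :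
    stress σ N y 0 k a p q =
      ∑ i : Fin (N + 1), (Pi.single k (EuclideanSpace.single a (1 : ℝ)) : Vel N) i p *
        (Pi.single k (EuclideanSpace.single a (1 : ℝ)) : Vel N) i q := rfl

/-- The degenerate normals of the landed Negative lemma `reflectVel_of_inner_eq_zero` (S3) are the
`c = 0` case of STUB 2 (A): a normal orthogonal to the relative impulse transfers nothing, `kick n g = 0`. -/
theorem kick_of_inner_eq_zero (n g : E3) (h : ⟪g, n⟫_ℝ = 0) : kick n g = 0 := by
  funext p q
  simp [kick, h]

end

end Summit.AtomisticToContinuum.HydrodynamicLimit.Cruxes.AdaptedWeightCLT.ImpulseStressContraction
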